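import Summits.QuantumFields.BalabanUV.T4Continuum.Support.TermwiseBackgroundBinders

/-!
# TermwiseHolder (part 1/4) — THE HÖLDER EXPONENT: the (U)(L) share of `δ_K` from an `ℓ²` oscillation profile,
in place of the `β₀ = 1` endpoint that print does not deliver

HONEST FRAMING (T4-DAG page 1, repeated on purpose). This file is bookkeeping on a FIXED FINITE four-torus at rung
(B)+1 of the cell's ladder: it concerns existence/uniqueness of the `ε → 0` limit of unit-scale block-averaged
expectations in finite volume, CONDITIONALLY. It is NOT infinite volume, NOT a mass gap, NOT the Clay statement, and
NOT a proof of the spine estimate NE7 (matching of the two runs' constants with `Σ_K δ_K < ∞`). NE7 is NOT PRINTED in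
[Balaban1984PropagatorsI]–[Balaban1989LargeFieldII] (one run at fixed `ε`, bounds uniform in `ε`; no two-run comparison) and
is NOT proved here. No sentence of print is quoted in this file; nothing printed is asserted. ABSOLUTE RULE honoured:
every hypothesis below is a NAMED binder of the theorem; none is minted as a fact, none is hidden in a definition.

PLACEMENT (cell pub-balaban, LEAN PLACEMENT RULE 2026-08-19 + gate `lint.literature-cited-only`): the cell's OWN
bookkeeping mathematics (no declaration types a published statement; bracketed keys are CONTEXT, not cite tags), hence
under `Summits/QuantumFields/BalabanUV/T4Continuum/`, importing the lineage's Literature modules and its Summits-side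
leaf `Support/TermwiseBackground*` (generation 14).  400-line cap: FOUR modules sharing this namespace —
`Support/TermwiseHolder` (§1–§3), `Support/TermwiseHolderUN` (§4–§5), `Support/TermwiseHolderBinders` (§6–§7),
`Support/TermwiseHolderExponent` (§8–§9).

## What this leaf does (generation 15 of lineage t4-ne7-p1; technique: TERM-WISE matching — bound `δ_K` from the
one-step rates composed along the tower and show summability from the geometric factors)
Generation 14 (`TermwiseBackground.goodClause_summable_UN_of_locReg`) located the background INPUT of the `U(N)`
term-wise chain in ONE binder per run, `hAreg`/`hBreg`: at every level `K` the background is `LocReg` about every site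
with radii `a₀ε₁L^{−K}` (size of the local potential `B`), `a₁ε₁L^{−2K}` (first differences), `a₂ε₁L^{−3K}` (ALL
mixed second differences `∇_ι∇_{ι'}B`).  The third radius is the `β₀ = 1` (Lipschitz-`∇B`) endpoint of a Hölder
clause; the cell's B11 seats have since LOCATED (sibling `…Balaban1983to89.B11Holder9`, its module docstring; cell GAPS
C-B8-18, G-B11-F3a, G-B11-G16a) that the printed regularity theory delivers the Hölder seminorm of the first covariant
derivatives only for exponents `0 ≤ β ≤ β₀ < 1`, with a constant unbounded as `β₀ ↑ 1`, and pointwise second-order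
information only for `∂*∂` and `Δ` — so the endpoint radius `a₂ε₁L^{−3K}` is a type print does not derive, even for
one run's minimiser.  On the unit lattice of level `K` a `β`-Hölder bound on `∇^ηA` at scale `(L^Kη)^{−2−β}` reads
`‖∇_ι∇_{ι'}B‖ ≤ a₂ε₁(L^{−K})^{2+β} = a₂ε₁L^{−2K}·ϑ^K`, `ϑ = L^{−β} ∈ [L^{−1}, 1)`.

THIS LEAF re-runs the interpolation–averaging chain with the second-difference radius `a₂ε₁L^{−2K}·h_K` for an
ARBITRARY profile `h : ℕ → ℝ` with `L^{−K} ≤ h_K` and `Σ_K h_K² < ∞` (the RELATIVE OSCILLATION MODULUS of the lift: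
window oscillation `ω_K ≤ c₂ε₁L^{−2(K+1)}·h_K`).  RESULT: the (U) share of `δ_K` becomes
`n₀·(c₂²ε₁²/4·h_K² + (c₁c₃ε₁³ + q₄(c₁ε₁ + c₃ε₁²)⁴)·(L⁻²)^K)` — the oscillation enters ONLY through `h_K²`, with NO
geometric factor of its own (the factor `L^{−2K}` of generation 10 was `h_K² = (L^{−K})²` all along) — the (L) share is
unchanged, and `Summable δ⁗` holds as soon as `h ∈ ℓ²`.  For the printed-derivable Hölder profile `h_K = ϑ^K`,
`ϑ = L^{−β₀}`, `0 < β₀ < 1`, the (U) share is geometric with ratio `max(ϑ², L⁻²) = L^{−2β₀} < 1`; `ϑ = L^{−1}`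
(`β₀ = 1`) is generation 14 literally (`dUP … (K ↦ L^{−K}) = dUN …`).  So the located input drops from the non-derivable
endpoint type to the derivable one, and the technique's "summability from the geometric factors" is exhibited at the
weakest profile that still sums: `ℓ²`.  Whether the two runs' backgrounds ARE `LocReg` with such radii is NOT asserted —
it stays the hypothesis `hAreg`/`hBreg`, by name; so do (repr), (0.31), the ledger kinds, `M⁴ ≤ vol`, the smallness.

* §1 [folklore] real arithmetic: the (U) size bound at scale `a` with window oscillation `ω ≤ c₂ε₁b²·h`
  (`interpolationSize_le_profile`; the `ω`-free part is generation 10's `interpolationSize_le_scale` at `ω = 0`).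
* §2 [folklore]: `K ↦ n₀(C₁h_K² + C₂(L⁻²)^K)` is non-negative and summable for `h ∈ ℓ²` (`profileRate_nonneg_summable`);
  the geometric profile `ϑ^K`, `L⁻¹ ≤ ϑ < 1`, and the endpoint profile `L^{−K}` qualify (`profile_geometric`,
  `profile_endpoint`).
* §3 [folklore] (U)(L) PRODUCED along the tower from the regularity of one step with an `ℓ²` oscillation profile
  (`interpolation_averaging_of_profile`: generation 10's `interpolation_averaging_of_regular` with `hω` re-typed).
* §4–§5 (part 2): `U(N)` Wilson terms — `dUP`, `interpolation_averaging_UN_profile`, the ledger theorem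
  `goodClause_summable_UN_profile`.  §6–§7 (part 3): the binders from `LocReg` with profile radii
  (`binders_of_locRegProfile`) and the two capstones `…_of_locRegProfile`.  §8–§9 (part 4): the Hölder exponent
  (`ϑ = L^{−β}` dictionary via `B11Holder9.rate_pow_eq`, by name; the producer and the ledger theorem READ AT
  `h_K = (L^{−β₀})^K`, `0 < β₀ ≤ 1`: `…_of_locRegHolder`), the endpoint `β₀ = 1` recovers generation 14, toys.

Loci named for orientation only (nothing quoted, nothing asserted): [Balaban1985Variational] Thm 1 (9)–(10);
[Balaban1985RegularSpaces] Thm 2 (1.36), (1.39); cell records `t4/T4-EST-NE7-P1.md` §19, `b2b-balaban-b11/HOLDER-9.md`.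
-/

noncomputable section

open Finset MeasureTheory _root_.Filter _root_.Topology NormedSpace
open scoped BigOperators InnerProductSpace

namespace Summit.QuantumFields.BalabanUV.T4Continuum.TermwiseHolder

open Literature.MathematicalPhysics.QuantumFieldTheory.Balaban1983to89
open T4TermwiseQuartic

/-! ## §1 The (U) size bound at scale `a` with an oscillation profile factor -/

section Scaling

/-- **(U) AT SCALE `a`, PROFILE FORM.**  As generation 10's `interpolationSize_le_scale`, with the window oscillation
`ω ≤ c₂ε₁b²·h` (`h` a free real, the relative oscillation modulus at this scale) in place of `ω ≤ c₂ε₁b²a`: the (U)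
size bound is `≤ vol·(n₀·(c₂²ε₁²/4·h² + (c₁c₃ε₁³ + q(c₁ε₁ + c₃ε₁²)⁴)·a²))` — the oscillation contributes `h²` and NO
power of `a` (`Nc·(rω)²/4 ≤ c₂²ε₁²h²/4·(Nc a⁴)` as `r b² = a²`). [folklore] -/
theorem interpolationSize_le_profile {q r s ω ρb Nc n₀ vol c₁ c₂ c₃ ε₁ a b h : ℝ} (hq : 0 ≤ q) (hr : 0 ≤ r)
    (hn₀ : 0 ≤ n₀) (hvol : 0 ≤ vol) (hc₁ : 0 ≤ c₁) (hc₃ : 0 ≤ c₃) (hε₁ : 0 ≤ ε₁)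
    (ha0 : 0 < a) (ha1 : a ≤ 1) (hrb : r * b ^ 2 = a ^ 2)
    (hs0 : 0 ≤ s) (hs : s ≤ c₁ * ε₁ * b ^ 2) (hω0 : 0 ≤ ω) (hω : ω ≤ c₂ * ε₁ * b ^ 2 * h)
    (hρ0 : 0 ≤ ρb) (hρb : ρb ≤ c₃ * ε₁ ^ 2 * a ^ 4) (hNc0 : 0 ≤ Nc) (hNc : Nc * a ^ 4 ≤ n₀ * vol) :
    Nc * (r ^ 2 * ω ^ 2 / 4 + r * s * ρb + q * (r * s + ρb) ^ 4)
      ≤ vol * (n₀ * (c₂ ^ 2 * ε₁ ^ 2 / 4 * h ^ 2 + (c₁ * c₃ * ε₁ ^ 3 + q * (c₁ * ε₁ + c₃ * ε₁ ^ 2) ^ 4) * a ^ 2)) := by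
  -- the `ω`-free part: generation 10's bound at `ω = 0`, `c₂ = 0`
  have rest := interpolationSize_le_scale (ω := 0) (c₂ := 0) hq hr hn₀ hvol hc₁ hc₃ hε₁ ha0 ha1 hrb hs0 hs le_rfl
    (by simp) hρ0 hρb hNc0 hNc
  -- the oscillation part
  have hrω : r * ω ≤ c₂ * ε₁ * a ^ 2 * h := by
    calc r * ω ≤ r * (c₂ * ε₁ * b ^ 2 * h) := mul_le_mul_of_nonneg_left hω hr
      _ = c₂ * ε₁ * h * (r * b ^ 2) := by ring
      _ = c₂ * ε₁ * a ^ 2 * h := by rw [hrb]; ring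
  have u1 : Nc * (r ^ 2 * ω ^ 2 / 4) ≤ c₂ ^ 2 * ε₁ ^ 2 / 4 * h ^ 2 * (n₀ * vol) := by
    have h2 : (r * ω) ^ 2 ≤ (c₂ * ε₁ * a ^ 2 * h) ^ 2 := pow_le_pow_left₀ (mul_nonneg hr hω0) hrω 2
    calc Nc * (r ^ 2 * ω ^ 2 / 4) = Nc * ((r * ω) ^ 2 / 4) := by ring
      _ ≤ Nc * ((c₂ * ε₁ * a ^ 2 * h) ^ 2 / 4) := mul_le_mul_of_nonneg_left (by gcongr) hNc0
      _ = c₂ ^ 2 * ε₁ ^ 2 / 4 * h ^ 2 * (Nc * a ^ 4) := by ring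
      _ ≤ c₂ ^ 2 * ε₁ ^ 2 / 4 * h ^ 2 * (n₀ * vol) := mul_le_mul_of_nonneg_left hNc (by positivity)
  have e1 : Nc * (r ^ 2 * ω ^ 2 / 4 + r * s * ρb + q * (r * s + ρb) ^ 4)
      = Nc * (r ^ 2 * ω ^ 2 / 4) + Nc * (r ^ 2 * (0 : ℝ) ^ 2 / 4 + r * s * ρb + q * (r * s + ρb) ^ 4) := by ring
  have e2 : vol * (n₀ * (c₂ ^ 2 * ε₁ ^ 2 / 4 * h ^ 2 + (c₁ * c₃ * ε₁ ^ 3 + q * (c₁ * ε₁ + c₃ * ε₁ ^ 2) ^ 4) * a ^ 2))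
      = c₂ ^ 2 * ε₁ ^ 2 / 4 * h ^ 2 * (n₀ * vol)
        + vol * (n₀ * ((0 : ℝ) ^ 2 * ε₁ ^ 2 / 4 + c₁ * c₃ * ε₁ ^ 3 + q * (c₁ * ε₁ + c₃ * ε₁ ^ 2) ^ 4) * a ^ 2) := by
    ring
  rw [e1, e2]
  exact add_le_add u1 rest

/-! ## §2 Summability of the profile majorant; the two profiles of record -/

/-- `K ↦ n₀·(C₁·h_K² + C₂·(L⁻²)^K)` is non-negative and summable for `1 < L`, `0 ≤ n₀, C₁, C₂` and `h ∈ ℓ²`.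
[folklore] -/
theorem profileRate_nonneg_summable {L n₀ C₁ C₂ : ℝ} {h : ℕ → ℝ} (hL : 1 < L) (hn₀ : 0 ≤ n₀) (hC₁ : 0 ≤ C₁)
    (hC₂ : 0 ≤ C₂) (hh : Summable (fun K => h K ^ 2)) :
    (∀ K : ℕ, 0 ≤ n₀ * (C₁ * h K ^ 2 + C₂ * ((L ^ 2)⁻¹) ^ K)) ∧
      Summable (fun K : ℕ => n₀ * (C₁ * h K ^ 2 + C₂ * ((L ^ 2)⁻¹) ^ K)) := by
  have h0 : 0 ≤ (L ^ 2)⁻¹ := by positivity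
  have h1 : (L ^ 2)⁻¹ < 1 := inv_lt_one_of_one_lt₀ (by nlinarith)
  refine ⟨fun K => by positivity, ?_⟩
  exact ((hh.mul_left C₁).add ((summable_geometric_of_lt_one h0 h1).mul_left C₂)).mul_left n₀

/-- **The geometric (Hölder) profile.**  For `1 < L` and `L⁻¹ ≤ ϑ < 1` the profile `h_K = ϑ^K` dominates the endpoint
(`L^{−K} ≤ ϑ^K`), is at most `1`, and is square-summable. [folklore] -/
theorem profile_geometric {L ϑ : ℝ} (hL : 1 < L) (hϑL : L⁻¹ ≤ ϑ) (hϑ1 : ϑ < 1) :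
    (∀ K : ℕ, (L ^ K)⁻¹ ≤ ϑ ^ K ∧ ϑ ^ K ≤ 1) ∧ Summable (fun K : ℕ => (ϑ ^ K) ^ 2) := by
  have hL0 : 0 < L := by linarith
  have hϑ0 : 0 ≤ ϑ := le_trans (inv_nonneg.2 hL0.le) hϑL
  refine ⟨fun K => ⟨?_, pow_le_one₀ hϑ0 hϑ1.le⟩, ?_⟩
  · rw [← inv_pow]
    exact pow_le_pow_left₀ (inv_nonneg.2 hL0.le) hϑL K
  · have h2 : ϑ ^ 2 < 1 := pow_lt_one₀ hϑ0 hϑ1 two_ne_zero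
    exact (summable_geometric_of_lt_one (sq_nonneg ϑ) h2).congr fun K => pow_right_comm ϑ 2 K

/-- **The endpoint profile** `h_K = L^{−K}` (generation 14's, `β₀ = 1`): it is the geometric profile at `ϑ = L⁻¹`.
[folklore] -/
theorem profile_endpoint {L : ℝ} (hL : 1 < L) :
    (∀ K : ℕ, (L ^ K)⁻¹ ≤ (L ^ K)⁻¹ ∧ (L ^ K)⁻¹ ≤ 1) ∧ Summable (fun K : ℕ => ((L ^ K)⁻¹) ^ 2) := by
  obtain ⟨h1, h2⟩ := profile_geometric hL le_rfl (inv_lt_one_of_one_lt₀ hL)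
  simp only [inv_pow] at h1 h2 ⊢
  exact ⟨fun K => ⟨le_rfl, (h1 K).2⟩, h2⟩

end Scaling

/-! ## §3 (U) and (L) PRODUCED along the tower from the regularity of one step, `ℓ²` oscillation profile -/

section Indexed

variable {V : Type*} [NormedAddCommGroup V] [InnerProductSpace ℝ V] {Xf Xc : Type*} {ι : Type} {σ : Type*}
  [DecidableEq σ] {l₀ vol : ℝ} {T : ℕ → Finset σ} {Bad : ℕ → ℝ → Finset σ} {Adm : Set ι}

/-- **(U)(L) PRODUCED FROM THE REGULARITY OF ONE RENORMALISATION STEP, `ℓ²` OSCILLATION PROFILE.**  Generation 10's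
`T4TermwiseQuartic.interpolation_averaging_of_regular` — binders (wt)(ker)(cnt)(repr-U)(tr-U)(bch-U)(sz-U)(osc-U)
(repr-L)(tr-L)(bch-L)(sz-L)(scal) BY NAME and VERBATIM — with ONE re-typed binder: the oscillation law is
`0 ≤ ω_K ≤ c₂ε₁L^{−2(K+1)}·h_K` for a profile `h : ℕ → ℝ` with `Σ_K h_K² < ∞` (`hh`), in place of
`ω_K ≤ c₂ε₁L^{−2(K+1)}L^{−K}`.  OUTPUT: (U) `hUdev`, (L) `hLdev`, `hdU0`, `hdL0`, `hdU`, `hdL` with the majorants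
`dU_K = n₀·(c₂²ε₁²/4·h_K² + (c₁c₃ε₁³ + q₄(c₁ε₁ + c₃ε₁²)⁴)·(L⁻²)^K)` (summable because `h ∈ ℓ²`; geometric iff `h` is)
and the unchanged `dL_K = n₀·(c₁c₃ε₁³ + c₃²ε₁⁴/2 + q₄c₁⁴ε₁⁴)·(L⁻²)^K`. [folklore] -/
theorem interpolation_averaging_of_profile {Y YA : Type*} {g : ℕ → ℝ → σ → ι → YA → ℝ}
    {f₁ : ℕ → ℝ → σ → ι → Y → ℝ} {Q : ℕ → ℝ → σ → ι → Y → YA} {yA yB : ℕ → ℝ → σ → ι → Y}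
    {xA : ℕ → ℝ → σ → ι → YA} {Pf : ℕ → Finset Xf} {Pc : ℕ → Finset Xc} {w : ℕ → Xc → Xf → ℝ} {e : V → ℝ}
    {φA φB : ℕ → ℝ → σ → ι → Xf → V} {ψA ψB : ℕ → ℝ → σ → ι → Xc → V} {ΦA ΦB : ℕ → ℝ → σ → ι → Xc → Xf → V}
    {q₄ L n₀ c₁ c₂ c₃ ε₁ : ℝ} {s ω ρb h : ℕ → ℝ}
    (he : ∀ v, ‖v‖ ^ 2 / 2 - q₄ * ‖v‖ ^ 4 ≤ e v ∧ e v ≤ ‖v‖ ^ 2 / 2) (hq₄ : 0 ≤ q₄) (hL : 1 < L)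
    (hw : ∀ K, ∀ y ∈ Pc K, ∀ x ∈ Pf K, 0 ≤ w K y x) (hrow : ∀ K, ∀ y ∈ Pc K, ∑ x ∈ Pf K, w K y x = L ^ 2)
    (hcol : ∀ K, ∀ x ∈ Pf K, ∑ y ∈ Pc K, w K y x = (L ^ 2)⁻¹) (hn₀ : 0 ≤ n₀) (hvol : 0 ≤ vol)
    (hNf : ∀ K, ((Pf K).card : ℝ) ≤ n₀ * vol * (L ^ (K + 1)) ^ 4)
    (hNc : ∀ K, ((Pc K).card : ℝ) ≤ n₀ * vol * (L ^ K) ^ 4)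
    (hreprU : ∀ K t, |t| ≤ l₀ → ∀ τ ∈ T K \ Bad K t, ∀ v ∈ Adm,
      f₁ K t τ v (yA K t τ v) = ∑ x ∈ Pf K, e (φA K t τ v x) ∧
        g K t τ v (xA K t τ v) = ∑ y ∈ Pc K, e (ψA K t τ v y))
    (hΦA : ∀ K t, |t| ≤ l₀ → ∀ τ ∈ T K \ Bad K t, ∀ v ∈ Adm, ∀ y ∈ Pc K, ∀ x ∈ Pf K,
      ‖ΦA K t τ v y x‖ = ‖φA K t τ v x‖)
    (hρA : ∀ K t, |t| ≤ l₀ → ∀ τ ∈ T K \ Bad K t, ∀ v ∈ Adm, ∀ y ∈ Pc K,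
      ‖ψA K t τ v y - ∑ x ∈ Pf K, w K y x • ΦA K t τ v y x‖ ≤ ρb K)
    (hsA : ∀ K t, |t| ≤ l₀ → ∀ τ ∈ T K \ Bad K t, ∀ v ∈ Adm, ∀ x ∈ Pf K, ‖φA K t τ v x‖ ≤ s K)
    (hoscA : ∀ K t, |t| ≤ l₀ → ∀ τ ∈ T K \ Bad K t, ∀ v ∈ Adm, ∀ y ∈ Pc K, ∀ x ∈ Pf K, ∀ x' ∈ Pf K,
      0 < w K y x → 0 < w K y x' → ‖ΦA K t τ v y x - ΦA K t τ v y x'‖ ≤ ω K)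
    (hreprL : ∀ K t, |t| ≤ l₀ → ∀ τ ∈ T K \ Bad K t, ∀ v ∈ Adm,
      f₁ K t τ v (yB K t τ v) = ∑ x ∈ Pf K, e (φB K t τ v x) ∧
        g K t τ v (Q K t τ v (yB K t τ v)) = ∑ y ∈ Pc K, e (ψB K t τ v y))
    (hΦB : ∀ K t, |t| ≤ l₀ → ∀ τ ∈ T K \ Bad K t, ∀ v ∈ Adm, ∀ y ∈ Pc K, ∀ x ∈ Pf K,
      ‖ΦB K t τ v y x‖ = ‖φB K t τ v x‖)
    (hρB : ∀ K t, |t| ≤ l₀ → ∀ τ ∈ T K \ Bad K t, ∀ v ∈ Adm, ∀ y ∈ Pc K,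
      ‖ψB K t τ v y - ∑ x ∈ Pf K, w K y x • ΦB K t τ v y x‖ ≤ ρb K)
    (hsB : ∀ K t, |t| ≤ l₀ → ∀ τ ∈ T K \ Bad K t, ∀ v ∈ Adm, ∀ x ∈ Pf K, ‖φB K t τ v x‖ ≤ s K)
    (hc₁ : 0 ≤ c₁) (hc₃ : 0 ≤ c₃) (hε₁ : 0 ≤ ε₁)
    (hs : ∀ K, 0 ≤ s K ∧ s K ≤ c₁ * ε₁ * ((L ^ (K + 1))⁻¹) ^ 2)
    (hω : ∀ K, 0 ≤ ω K ∧ ω K ≤ c₂ * ε₁ * ((L ^ (K + 1))⁻¹) ^ 2 * h K)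
    (hh : Summable (fun K => h K ^ 2))
    (hρb : ∀ K, 0 ≤ ρb K ∧ ρb K ≤ c₃ * ε₁ ^ 2 * ((L ^ K)⁻¹) ^ 4) :
    (∀ K t, |t| ≤ l₀ → ∀ τ ∈ T K \ Bad K t, ∀ v ∈ Adm,
      f₁ K t τ v (yA K t τ v) - g K t τ v (xA K t τ v)
        ≤ vol * (n₀ * (c₂ ^ 2 * ε₁ ^ 2 / 4 * h K ^ 2
          + (c₁ * c₃ * ε₁ ^ 3 + q₄ * (c₁ * ε₁ + c₃ * ε₁ ^ 2) ^ 4) * ((L ^ 2)⁻¹) ^ K))) ∧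
    (∀ K t, |t| ≤ l₀ → ∀ τ ∈ T K \ Bad K t, ∀ v ∈ Adm,
      g K t τ v (Q K t τ v (yB K t τ v)) - f₁ K t τ v (yB K t τ v)
        ≤ vol * (n₀ * (c₁ * c₃ * ε₁ ^ 3 + c₃ ^ 2 * ε₁ ^ 4 / 2 + q₄ * (c₁ ^ 4 * ε₁ ^ 4)) * ((L ^ 2)⁻¹) ^ K)) ∧
    (∀ K, 0 ≤ n₀ * (c₂ ^ 2 * ε₁ ^ 2 / 4 * h K ^ 2
        + (c₁ * c₃ * ε₁ ^ 3 + q₄ * (c₁ * ε₁ + c₃ * ε₁ ^ 2) ^ 4) * ((L ^ 2)⁻¹) ^ K)) ∧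
    (∀ K, 0 ≤ n₀ * (c₁ * c₃ * ε₁ ^ 3 + c₃ ^ 2 * ε₁ ^ 4 / 2 + q₄ * (c₁ ^ 4 * ε₁ ^ 4)) * ((L ^ 2)⁻¹) ^ K) ∧
    Summable (fun K => n₀ * (c₂ ^ 2 * ε₁ ^ 2 / 4 * h K ^ 2
        + (c₁ * c₃ * ε₁ ^ 3 + q₄ * (c₁ * ε₁ + c₃ * ε₁ ^ 2) ^ 4) * ((L ^ 2)⁻¹) ^ K)) ∧
    Summable (fun K => n₀ * (c₁ * c₃ * ε₁ ^ 3 + c₃ ^ 2 * ε₁ ^ 4 / 2 + q₄ * (c₁ ^ 4 * ε₁ ^ 4)) * ((L ^ 2)⁻¹) ^ K) := by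
  have hL0 : 0 < L := by linarith
  have hL2 : (0 : ℝ) ≤ L ^ 2 := by positivity
  have hrc : L ^ 2 * (L ^ 2)⁻¹ = 1 := mul_inv_cancel₀ (pow_ne_zero 2 hL0.ne')
  have hU := profileRate_nonneg_summable hL hn₀ (show 0 ≤ c₂ ^ 2 * ε₁ ^ 2 / 4 by positivity)
    (show 0 ≤ c₁ * c₃ * ε₁ ^ 3 + q₄ * (c₁ * ε₁ + c₃ * ε₁ ^ 2) ^ 4 by positivity) hh
  have hLs := geometricRate_nonneg_summable hL
    (show 0 ≤ n₀ * (c₁ * c₃ * ε₁ ^ 3 + c₃ ^ 2 * ε₁ ^ 4 / 2 + q₄ * (c₁ ^ 4 * ε₁ ^ 4)) by positivity)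
  refine ⟨fun K t ht τ hτ v hv => ?_, fun K t ht τ hτ v hv => ?_, hU.1, hLs.1, hU.2, hLs.2⟩
  · obtain ⟨ha0, ha1, hb0, hba, hrb, hξ⟩ := scale_facts hL K
    obtain ⟨e1, e2⟩ := hreprU K t ht τ hτ v hv
    have key := interpolationError_le_of_sizes (Pf K) (Pc K) he hq₄ (hw K) hL2 (hrow K) (hcol K) hrc.symm.le
      (hΦA K t ht τ hτ v hv) (hs K).1 (hsA K t ht τ hτ v hv) (hoscA K t ht τ hτ v hv) (hρb K).1
      (hρA K t ht τ hτ v hv) le_rfl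
    have sc := interpolationSize_le_profile hq₄ hL2 hn₀ hvol hc₁ hc₃ hε₁ ha0 ha1 hrb (hs K).1 (hs K).2 (hω K).1
      (hω K).2 (hρb K).1 (hρb K).2 (Nat.cast_nonneg _) (count_mul_inv_pow_le (pow_pos hL0 K) (hNc K))
    rw [e1, e2, ← hξ]
    exact key.trans sc
  · obtain ⟨ha0, ha1, hb0, hba, hrb, hξ⟩ := scale_facts hL K
    obtain ⟨e1, e2⟩ := hreprL K t ht τ hτ v hv
    have key := averagingError_le_of_sizes (Pf K) (Pc K) he hq₄ (hw K) hL2 (fun y hy => (hrow K y hy).le)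
      (fun x hx => (hcol K x hx).le) hrc.le (hΦB K t ht τ hτ v hv) (hs K).1 (hsB K t ht τ hτ v hv) (hρb K).1
      (hρB K t ht τ hτ v hv) le_rfl le_rfl
    have sc := averagingSize_le_scale hq₄ hL2 hn₀ hvol hc₁ hc₃ hε₁ ha0 ha1 hb0 hba hrb (hs K).1 (hs K).2
      (hρb K).1 (hρb K).2 (Nat.cast_nonneg _) (count_mul_inv_pow_le (pow_pos hL0 (K + 1)) (hNf K))
      (Nat.cast_nonneg _) (count_mul_inv_pow_le (pow_pos hL0 K) (hNc K))
    rw [e1, e2, ← hξ]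
    exact key.trans sc

end Indexed

end Summit.QuantumFields.BalabanUV.T4Continuum.TermwiseHolder
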